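import Summits.Ventures.HodgeRepro2.A2PontryaginTable
import Summits.Ventures.HodgeRepro2.A2HodgeNumbers

/-!
# A2PontryaginBigraded — the Pontryagin product is bigraded of bidegree `(−n, −n)`

Tier-4 annex of sub-claim A2 (seat p6, cell pub-hodge-repro2); §8(d): uses an L-value-free
non-vanishing device: NO.

Row 121 proved that `z ⋆ θ^k` has bidegree `(a, b)` when `z` has bidegree `(a+(n−k), b+(n−k))`
(`pontryagin_theta_pow_mem_hgrading`, for the specific right factor `θ^k`).  Here the general
rule, for ARBITRARY factors: `z ∈ hgrading a b`, `x ∈ hgrading a' b'` give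
`z ⋆ x ∈ hgrading (a + a' − n) (b + b' − n)` (`pontryagin_mem_hgrading`; `n = |ι|`, natural
subtraction — when `a + a' < n` or `b + b' < n` the product is `0`).  The proof is the
multiplication table of row 128 on the basis monomials (`e_s ⋆ e_t = ± vol • e_{s∩t}` iff
`s ∪ t = univ`, and then `bideg (s ∩ t) = bideg s + bideg t − (n, n)`) extended by bilinearity.

In the prose: the Pontryagin product `m_*` is a morphism of Hodge structures of bidegree
`(−n, −n)` (A4.3.3 / (S3)); the twelve-plane instance `pontryagin_mem_two_two`: a `(10,10)`-class
times ANY `(4,4)`-class is a `(2,2)`-class (row 121 had it for `θ^4`).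

What stays prose: the identification of the model's bigrading with the Hodge decomposition of
`H^*(B, ℂ)`; not on the N1 chain.
-/

namespace Summit.Ventures.HodgeRepro2.A2PontryaginBigraded

open WeilPlanes WeilIntegral WeilCoproduct A2ModelDuality A2PontryaginModel A2HodgeTypeModel
  A2HodgeBigrading A2HodgeNumbers A2PontryaginTable

variable {ι : Type*} [DecidableEq ι] [Fintype ι]

/-- `sA (s ∩ t) = sA s ∩ sA t`. -/
theorem sA_inter (s t : Finset (Fin (Fintype.card (Gen ι)))) : sA (s ∩ t) = sA s ∩ sA t := by
  ext p
  simp [mem_sA]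

/-- `sB (s ∩ t) = sB s ∩ sB t`. -/
theorem sB_inter (s t : Finset (Fin (Fintype.card (Gen ι)))) : sB (s ∩ t) = sB s ∩ sB t := by
  ext p
  simp [mem_sB]

/-- `sA (s ∪ t) = sA s ∪ sA t`. -/
theorem sA_union (s t : Finset (Fin (Fintype.card (Gen ι)))) : sA (s ∪ t) = sA s ∪ sA t := by
  ext p
  simp [mem_sA]

/-- `sB (s ∪ t) = sB s ∪ sB t`. -/
theorem sB_union (s t : Finset (Fin (Fintype.card (Gen ι)))) : sB (s ∪ t) = sB s ∪ sB t := by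
  ext p
  simp [mem_sB]

omit [DecidableEq ι] in
/-- `sA univ = univ`. -/
theorem sA_univ : sA (Finset.univ : Finset (Fin (Fintype.card (Gen ι)))) = Finset.univ := by
  ext p
  simp [mem_sA]

omit [DecidableEq ι] in
/-- `sB univ = univ`. -/
theorem sB_univ : sB (Finset.univ : Finset (Fin (Fintype.card (Gen ι)))) = Finset.univ := by
  ext p
  simp [mem_sB]

/-- When `s ∪ t = univ`, `bideg (s ∩ t) = bideg s + bideg t − (n, n)`. -/
theorem bideg_inter (s t : Finset (Fin (Fintype.card (Gen ι)))) (hst : s ∪ t = Finset.univ) :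
    bideg (s ∩ t) = ((bideg s).1 + (bideg t).1 - Fintype.card ι,
      (bideg s).2 + (bideg t).2 - Fintype.card ι) := by
  have hA : sA s ∪ sA t = Finset.univ := by rw [← sA_union, hst, sA_univ]
  have hB : sB s ∪ sB t = Finset.univ := by rw [← sB_union, hst, sB_univ]
  have h1 := Finset.card_union_add_card_inter (sA s) (sA t)
  have h2 := Finset.card_union_add_card_inter (sB s) (sB t)
  rw [hA, Finset.card_univ] at h1
  rw [hB, Finset.card_univ] at h2
  rw [bideg_eq, bideg_eq, bideg_eq, sA_inter, sB_inter]
  simp only [Prod.mk.injEq]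
  omega

/-- The table of row 128 with the bidegrees: `e_s ⋆ e_t ∈ hgrading (a + a' − n) (b + b' − n)` for
`bideg s = (a, b)`, `bideg t = (a', b')`. -/
theorem pontryagin_aBasis_mem_hgrading (s t : Finset (Fin (Fintype.card (Gen ι)))) :
    pontryagin (aBasis s) (aBasis t) ∈
      hgrading ((bideg s).1 + (bideg t).1 - Fintype.card ι)
        ((bideg s).2 + (bideg t).2 - Fintype.card ι) := by
  obtain ⟨ε, -, h⟩ := pontryagin_aBasis_aBasis (ι := ι) s t
  rw [h]
  by_cases hst : s ∪ t = Finset.univ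
  · rw [if_pos hst]
    have hb := bideg_inter s t hst
    have h1 : (bideg (s ∩ t)).1 = (bideg s).1 + (bideg t).1 - Fintype.card ι := by rw [hb]
    have h2 : (bideg (s ∩ t)).2 = (bideg s).2 + (bideg t).2 - Fintype.card ι := by rw [hb]
    rw [← h1, ← h2]
    exact Submodule.smul_mem _ _ (aBasis_mem_hgrading _)
  · rw [if_neg hst]
    exact Submodule.zero_mem _

/-- THE PONTRYAGIN PRODUCT IS BIGRADED OF BIDEGREE `(−n, −n)`: `z ∈ hgrading a b` and
`x ∈ hgrading a' b'` give `z ⋆ x ∈ hgrading (a + a' − n) (b + b' − n)`. -/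
theorem pontryagin_mem_hgrading {a b a' b' : ℕ} {z x : A ι} (hz : z ∈ hgrading a b)
    (hx : x ∈ hgrading a' b') :
    pontryagin z x ∈ hgrading (a + a' - Fintype.card ι) (b + b' - Fintype.card ι) := by
  have h0l : ∀ w : A ι, pontryagin (0 : A ι) w = 0 := fun w => by
    have := pontryagin_smul_left (0 : ℂ) (0 : A ι) w
    rwa [zero_smul, zero_smul] at this
  have h0r : ∀ w : A ι, pontryagin w (0 : A ι) = 0 := fun w => by
    have := A2PontryaginFullPlane.pontryagin_smul_right (0 : ℂ) w (0 : A ι)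
    rwa [zero_smul, zero_smul] at this
  rw [hgrading_eq_span] at hz hx
  refine Submodule.span_induction (p := fun z _ => pontryagin z x ∈
    hgrading (a + a' - Fintype.card ι) (b + b' - Fintype.card ι)) ?_ ?_ ?_ ?_ hz
  · rintro _ ⟨s, hs, rfl⟩
    rw [Set.mem_setOf_eq] at hs
    refine Submodule.span_induction (p := fun x _ => pontryagin (aBasis s) x ∈
      hgrading (a + a' - Fintype.card ι) (b + b' - Fintype.card ι)) ?_ ?_ ?_ ?_ hx
    · rintro _ ⟨t, ht, rfl⟩
      rw [Set.mem_setOf_eq] at ht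
      have := pontryagin_aBasis_mem_hgrading (ι := ι) s t
      rwa [hs, ht] at this
    · rw [h0r]
      exact Submodule.zero_mem _
    · intro x y _ _ hx hy
      rw [A2PontryaginFullPlane.pontryagin_add_right]
      exact Submodule.add_mem _ hx hy
    · intro r x _ hx
      rw [A2PontryaginFullPlane.pontryagin_smul_right]
      exact Submodule.smul_mem _ _ hx
  · rw [h0l]
    exact Submodule.zero_mem _
  · intro z z' _ _ hz hz'
    rw [pontryagin_add_left]
    exact Submodule.add_mem _ hz hz'
  · intro r z _ hz
    rw [pontryagin_smul_left]
    exact Submodule.smul_mem _ _ hz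

/-- Row 121's shape for an ARBITRARY right factor of type `(k, k)`: `z` of bidegree
`(a + (n − k), b + (n − k))` and `x` of bidegree `(k, k)`, `k ≤ n`, give `z ⋆ x` of bidegree `(a, b)`. -/
theorem pontryagin_mem_hgrading_of_type {k a b : ℕ} (hk : k ≤ Fintype.card ι) {z x : A ι}
    (hz : z ∈ hgrading (a + (Fintype.card ι - k)) (b + (Fintype.card ι - k)))
    (hx : x ∈ hgrading k k) : pontryagin z x ∈ hgrading a b := by
  have := pontryagin_mem_hgrading hz hx
  have e : a + (Fintype.card ι - k) + k - Fintype.card ι = a := by omega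
  have e' : b + (Fintype.card ι - k) + k - Fintype.card ι = b := by omega
  rwa [e, e'] at this

/-- THE TWELVE-PLANE INSTANCE: a `(10,10)`-class times ANY `(4,4)`-class is a `(2,2)`-class
(row 121's `pontryagin_theta_pow_four_mem_two_two` for `x = θ^4`). -/
theorem pontryagin_mem_two_two {z x : A A2TwelvePlanes.ι₁₂} (hz : z ∈ hgrading 10 10)
    (hx : x ∈ hgrading 4 4) : pontryagin z x ∈ hgrading 2 2 := by
  have := pontryagin_mem_hgrading hz hx
  rwa [A2TwelvePlanes.card_twelve] at this

end Summit.Ventures.HodgeRepro2.A2PontryaginBigraded
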